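import Summits.BirchSwinnertonDyer.Rank1Residual.GaloisImage.SakamotoN11InstanceLevelOneLocal
import Summits.BirchSwinnertonDyer.Rank1Residual.GaloisImage.PropagatedConditionCardEP
import Summits.BirchSwinnertonDyer.Rank1Residual.GaloisImage.UnramifiedOrthogonalOfIsPerfect
import HarnessLib

/-!
# The N11 level-one instance of [S24] Thm. 4.4 with `hEP` (and `hunro`) DISCHARGED: `χ(𝓕_can) = 1`
# for every `E/ℚ` at `p = 3` from the Poitou–Tate family ALONE, and level one from surj(3)
# (cell `b2b-bsdres`, team n1011; seat p04 GEN 9; consumer rule R5-75 (b)(i) for rows T-Lp / T-UO-K)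

HONEST FRAMING (cell `b2b-bsdres`, run/shared/lean/b2b/bsd-rank1-residual/, verbatim in every
file): the goal of the cell is to DELETE the COMBINATION-SHAPED residual classes of the
Birch–Swinnerton-Dyer formula for ALL analytic-rank `≤ 1` elliptic curves over `ℚ` — "full BSD
formula for every rank `≤ 1` curve in class `C`" assembled STRICTLY from published theorems — so
that the rank-`≤ 1` remainder becomes exactly the CONSTRUCTION-SHAPED classes, which are TYPED
(missing-input `Prop`s), NOT attempted. This is not "finishing BSD". Team n1011 (N10 / N11, the
additive block X4 ∧ `p = 3`): research route on the CONSTRUCTION-SHAPED class X4; no claim beyond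
the stated classes; nothing is booked; no mark / label is changed by this file. Theorems only (no
definition, no named fact, no `sorry`); the level-one theorems stay CONDITIONAL on the named fact
`hS24` (Sakamoto 2024 Thm. 4.4 (1)) exactly as their sources.

## What

Seat p04 gen 5 (`SakamotoN11InstanceLevelOneLocal`) gave n1011-p13's N11 instances with the located
local gap (Lp) and the injectivity discharged, under the binder `hEP` (Tate's local Euler–Poincaré
characteristic at the finite places of `ℚ`, then a named fact) and — for the level-one theorems —
`hunro : inv.UnramifiedOrthogonal`.  Both are now THEOREMS of the tree: `hEP` by row T-EPC
(`EPCTate.localEulerPoincareCharacteristic`, p300886; at `ℚ_v`: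
`EP.localEulerPoincareCharacteristic_adicCompletion`), `hunro` by row T-UO-K
(`UnramifiedCup.unramifiedOrthogonal_of_isPerfect`, p274339, Milne *ADT* I Thm. 2.6, from
`inv.IsPerfect` at the prime power `3`).  This file feeds them in (n1011 lead R5-75 (b)(i): by the
consumer's own hand, one theorem per statement), sub-namespace `EP`, names of the originals minus
`_of_localEuler`:

* `EP.hasCoreRank_one_propagatedSelmerStructureOne_of_isPerfect` — **`χ(𝓕_can(E[3])) = 1` for EVERY
  elliptic curve `E/ℚ`** from a Poitou–Tate family `inv` at `3` with its THREE properties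
  (`IsPerfect`, `SumLocalTermEqZero`, `SelmerComplement`) and any finite `T ⊇ {3} ∪ bad` — no local,
  finiteness, duality or Euler-characteristic binder remains;
* `EP.kolyvaginSystems_freeRankOne_levelOne_of_surj`,
  `EP.exists_tau_kolyvaginSystems_freeRankOne_levelOne_of_surj`,
  `EP.exists_kolyvaginDatum_kolyvaginSystems_freeRankOne_levelOne_of_surj` — p13's three level-one
  theorems from surj(3) with `hLpIm`, `hinj`, `hEP` AND `hunro` gone: what remains is the fact
  `hS24`, `[Finite E[3]]`, surj(3), the Poitou–Tate family with three properties, an admissible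
  `S ⊇ ∞ ∪ {3} ∪ bad` (and, in the first form, the `τ`-datum and the Kolyvagin datum).

Nothing is booked; the instances are TOOL theorems of the N11 hypothesis side and close no class.

References: R. Sakamoto, JTNB **36** (2024) Def. 3.6, Def. 3.8, Thm. 4.4 (pp. 923–926)
[Sakamoto2024]; J. S. Milne, *ADT* I Thm. 2.6, Thm. 2.8, Thm. 3.2, Lemma 3.3 [MilneADT2006];
K. Rubin, PCMS 18 (2011) Def. 1.9.6, Def. 2.1.3 [Rubin2011].
-/

noncomputable section

open scoped Classical NumberField ContRepresentation
open Field NumberField IsDedekindDomain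
open WeierstrassCurve Literature.NumberTheory.EllipticCurves Literature.NumberTheory.GaloisRepresentations
  Literature.NumberTheory.GaloisRepresentations.DiscreteGaloisModule Literature.NumberTheory.GaloisCohomology

namespace Summit.BirchSwinnertonDyer.Rank1Residual.GaloisImage

namespace EP

variable (W : WeierstrassCurve ℚ) [W.IsElliptic]

/-! ### `χ(𝓕_can) = 1` from the Poitou–Tate family alone -/

/-- **`χ(𝓕_can(E[3])) = 1` for EVERY elliptic curve `E/ℚ` at `p = 3`, from the Poitou–Tate family
ALONE**: for a family `inv` of local invariant maps at `3` with `IsPerfect`, `SumLocalTermEqZero` and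
`SelmerComplement`, and any finite `T ⊇ {3} ∪ bad`, the canonical structure `𝓕̄ = 𝓕_can(E[3])` has
core rank one — `#H¹_{𝓕̄}(ℚ, E[3]) = 3 · #H¹_{𝓕̄^*}(ℚ, E[3]^D)` (Sakamoto's "`χ(𝓕) = 1`").
`GaloisImage.hasCoreRank_one_propagatedSelmerStructureOne_of_isPerfect_of_localEuler` with `hEP`
discharged by p300886 (`EP.localEulerPoincareCharacteristic_adicCompletion`).
[cite: Sakamoto2024, Def. 3.6 (p. 923) and Thm. 4.4 (p. 926)] [cite: MilneADT2006, Ch. I, Thm. 2.8, Thm. 3.2 and Lemma 3.3] -/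
theorem hasCoreRank_one_propagatedSelmerStructureOne_of_isPerfect
    [Finite (geomTorsion W ((3 : ℕ) : ℤ))]
    (inv : LocalInvariants ℚ 3) (hperf : inv.IsPerfect) (hsum : inv.SumLocalTermEqZero)
    (hcompl : inv.SelmerComplement)
    (T : Finset (HeightOneSpectrum (𝓞 ℚ)))
    (h3T : ∀ v : HeightOneSpectrum (𝓞 ℚ), ((3 : ℕ) : 𝓞 ℚ) ∈ v.asIdeal → v ∈ T)
    (hbadT : ∀ v : HeightOneSpectrum (𝓞 ℚ), ¬ W.HasGoodReductionAt v → v ∈ T) :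
    LocalInvariants.HasCoreRank inv (propagatedSelmerStructureOne W 3) 3 1 :=
  GaloisImage.hasCoreRank_one_propagatedSelmerStructureOne_of_isPerfect_of_localEuler W inv hperf hsum
    hcompl (EP.forall_localEulerPoincareCharacteristic_adicCompletion ℚ) T h3T hbadT

/-! ### Level one from surj(3): `hLpIm`, `hinj`, `hEP`, `hunro` all discharged -/

/-- **Level one from surj(3) — no local gap, no Euler-characteristic binder, no orthogonality
binder**: `GaloisImage.kolyvaginSystems_freeRankOne_levelOne_of_surj_of_localEuler` with `hEP`
discharged by p300886 and `hunro` by `UnramifiedCup.unramifiedOrthogonal_of_isPerfect` (p274339).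
`KS₁(E[3], 𝓕_can, 𝒫(τ))` is free of rank one over `𝔽₃` (with the level-wise bijectivity clause)
given: the fact `hS24`, `[Finite E[3]]`, surj(3), the `τ`-datum, the Poitou–Tate family with
`IsPerfect` / `SumLocalTermEqZero` / `SelmerComplement`, an admissible `S ⊇ ∞ ∪ {3} ∪ {bad}`, and a
Kolyvagin datum on Sakamoto's primes with the cyclotomic transverse conditions and the canonical
comparison maps.  CONDITIONAL on `hS24`; nothing booked.
[cite: Sakamoto2024, Def. 3.6 (p. 923), Def. 3.8 (p. 924) and Thm. 4.4 (p. 926)] -/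
theorem kolyvaginSystems_freeRankOne_levelOne_of_surj
    (hS24 : Sakamoto2024.kolyvaginSystems_freeRankOne_zmod_three_pow)
    [Finite (geomTorsion W ((3 : ℕ) : ℤ))]
    (h3 : W.HasSurjectiveModNGaloisRep ((3 : ℕ) : ℤ))
    (τ : absoluteGaloisGroup ℚ) (hτμ : τ ∈ rootsOfUnityFixer ℚ (3 ^ (0 + 1)))
    (hτq : Nonempty (cokerSubOne (W.torsionGaloisModule (((3 : ℕ) : ℤ) ^ 0 * ((3 : ℕ) : ℤ))) τ ≃+
      ZMod (3 ^ (0 + 1))))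
    (inv : LocalInvariants ℚ 3) (hperf : inv.IsPerfect) (hsum : inv.SumLocalTermEqZero)
    (hcompl : inv.SelmerComplement)
    (S : Finset (Place ℚ)) (hS : ∀ w : InfinitePlace ℚ, (Sum.inl w : Place ℚ) ∈ S)
    (h3S : ∀ v : HeightOneSpectrum (𝓞 ℚ), ((3 : ℕ) : 𝓞 ℚ) ∈ v.asIdeal → (Sum.inr v : Place ℚ) ∈ S)
    (hbadS : ∀ v : HeightOneSpectrum (𝓞 ℚ), ¬ W.HasGoodReductionAt v → (Sum.inr v : Place ℚ) ∈ S)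
    (D : KolyvaginDatum (W.torsionGaloisModule (((3 : ℕ) : ℤ) ^ 0 * ((3 : ℕ) : ℤ))))
    (η : (q : HeightOneSpectrum (𝓞 ℚ)) → (ZMod (Ideal.absNorm q.asIdeal))ˣ)
    (hP : D.primes = frobeniusClassPrimes (W.torsionGaloisModule (((3 : ℕ) : ℤ) ^ 0 * ((3 : ℕ) : ℤ)))
      {v | (Sum.inr v : Place ℚ) ∈ S} τ (3 ^ (0 + 1)))
    (hT : D.transverse =
      cyclotomicTransverse (W.torsionGaloisModule (((3 : ℕ) : ℤ) ^ 0 * ((3 : ℕ) : ℤ))))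
    (hD : D.HasCanonicalComparison (3 ^ (0 + 1)) η) :
    KolyvaginSystem.IsFreeRankOneZMod (D.kolyvaginSystems (propagatedSelmerStructure W 3 0))
        (3 ^ (0 + 1)) ∧
      ∀ (d : Finset (HeightOneSpectrum (𝓞 ℚ))) (hd : D.IsLevel d),
        LocalInvariants.lambdaStar inv ((D.atLevel (propagatedSelmerStructure W 3 0) d).induced
          (W.torsionMulBy (((3 : ℕ) : ℤ) ^ 0) ((3 : ℕ) : ℤ))) 3 = 0 →
        Function.Bijective fun κ : D.kolyvaginSystems (propagatedSelmerStructure W 3 0) =>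
          (⟨κ.1 d, ((KolyvaginDatum.mem_kolyvaginSystems_iff D _ κ.1).mp κ.2).mem_selmerGroup
              d hd⟩ : (D.atLevel (propagatedSelmerStructure W 3 0) d).selmerGroup) :=
  GaloisImage.kolyvaginSystems_freeRankOne_levelOne_of_surj_of_localEuler W hS24 h3 τ hτμ hτq inv
    hperf hsum (UnramifiedCup.unramifiedOrthogonal_of_isPerfect inv Nat.prime_three.isPrimePow hperf)
    hcompl (EP.forall_localEulerPoincareCharacteristic_adicCompletion ℚ) S hS h3S hbadS D η hP hT hD

/-- **The `τ`-datum discharged existentially — no local gap, no `hEP`, no `hunro`**: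
`GaloisImage.exists_tau_kolyvaginSystems_freeRankOne_levelOne_of_surj_of_localEuler` with `hEP`
discharged by p300886 and `hunro` by p274339.  From surj(3) ALONE there IS `τ ∈ Gal(ℚ̄/ℚ(μ₃))` with
`E[3]/(τ − 1) ≃ 𝔽₃` such that — given `hS24`, the Poitou–Tate family (three properties) and an
admissible `S` — for every Kolyvagin datum on `𝒫(τ)` with the cyclotomic transverse conditions and the
canonical comparison maps, `KS₁(E[3], 𝓕_can, 𝒫(τ))` is free of rank one over `𝔽₃`.
CONDITIONAL on `hS24`; nothing booked. [cite: Sakamoto2024, §2 (H.2) (p. 921) and Thm. 4.4 (p. 926)] -/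
theorem exists_tau_kolyvaginSystems_freeRankOne_levelOne_of_surj
    (hS24 : Sakamoto2024.kolyvaginSystems_freeRankOne_zmod_three_pow)
    [Finite (geomTorsion W ((3 : ℕ) : ℤ))]
    (h3 : W.HasSurjectiveModNGaloisRep ((3 : ℕ) : ℤ))
    (inv : LocalInvariants ℚ 3) (hperf : inv.IsPerfect) (hsum : inv.SumLocalTermEqZero)
    (hcompl : inv.SelmerComplement)
    (S : Finset (Place ℚ)) (hS : ∀ w : InfinitePlace ℚ, (Sum.inl w : Place ℚ) ∈ S)
    (h3S : ∀ v : HeightOneSpectrum (𝓞 ℚ), ((3 : ℕ) : 𝓞 ℚ) ∈ v.asIdeal → (Sum.inr v : Place ℚ) ∈ S)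
    (hbadS : ∀ v : HeightOneSpectrum (𝓞 ℚ), ¬ W.HasGoodReductionAt v → (Sum.inr v : Place ℚ) ∈ S) :
    ∃ τ : absoluteGaloisGroup ℚ, τ ∈ rootsOfUnityFixer ℚ (3 ^ (0 + 1)) ∧
      Nonempty (cokerSubOne (W.torsionGaloisModule (((3 : ℕ) : ℤ) ^ 0 * ((3 : ℕ) : ℤ))) τ ≃+
        ZMod (3 ^ (0 + 1))) ∧
      ∀ (D : KolyvaginDatum (W.torsionGaloisModule (((3 : ℕ) : ℤ) ^ 0 * ((3 : ℕ) : ℤ))))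
        (η : (q : HeightOneSpectrum (𝓞 ℚ)) → (ZMod (Ideal.absNorm q.asIdeal))ˣ),
        D.primes = frobeniusClassPrimes (W.torsionGaloisModule (((3 : ℕ) : ℤ) ^ 0 * ((3 : ℕ) : ℤ)))
          {v | (Sum.inr v : Place ℚ) ∈ S} τ (3 ^ (0 + 1)) →
        D.transverse =
          cyclotomicTransverse (W.torsionGaloisModule (((3 : ℕ) : ℤ) ^ 0 * ((3 : ℕ) : ℤ))) →
        D.HasCanonicalComparison (3 ^ (0 + 1)) η →
        KolyvaginSystem.IsFreeRankOneZMod (D.kolyvaginSystems (propagatedSelmerStructure W 3 0))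
            (3 ^ (0 + 1)) ∧
          ∀ (d : Finset (HeightOneSpectrum (𝓞 ℚ))) (hd : D.IsLevel d),
            LocalInvariants.lambdaStar inv ((D.atLevel (propagatedSelmerStructure W 3 0) d).induced
              (W.torsionMulBy (((3 : ℕ) : ℤ) ^ 0) ((3 : ℕ) : ℤ))) 3 = 0 →
            Function.Bijective fun κ : D.kolyvaginSystems (propagatedSelmerStructure W 3 0) =>
              (⟨κ.1 d, ((KolyvaginDatum.mem_kolyvaginSystems_iff D _ κ.1).mp κ.2).mem_selmerGroup
                  d hd⟩ : (D.atLevel (propagatedSelmerStructure W 3 0) d).selmerGroup) :=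
  GaloisImage.exists_tau_kolyvaginSystems_freeRankOne_levelOne_of_surj_of_localEuler W hS24 h3 inv
    hperf hsum (UnramifiedCup.unramifiedOrthogonal_of_isPerfect inv Nat.prime_three.isPrimePow hperf)
    hcompl (EP.forall_localEulerPoincareCharacteristic_adicCompletion ℚ) S hS h3S hbadS

/-- **Everything constructible discharged, no local gap, no `hEP`, no `hunro`**:
`GaloisImage.exists_kolyvaginDatum_kolyvaginSystems_freeRankOne_levelOne_of_surj_of_localEuler` with
`hEP` discharged by p300886 and `hunro` by p274339.  From surj(3) ALONE — given the fact `hS24`, a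
Poitou–Tate family `inv` at `3` (`IsPerfect`, `SumLocalTermEqZero`, `SelmerComplement`) and an
admissible `S ⊇ ∞ ∪ {3} ∪ {bad}` — THERE ARE `τ`, `η` and a Kolyvagin datum `D` on Sakamoto's primes
`𝒫(τ)` with the cyclotomic transverse conditions and THE canonical comparison maps such that
`KS₁(E[3], 𝓕_can, 𝒫(τ))` is free of rank one over `𝔽₃` (with the level-wise bijectivity clause).
Level one, no tower: every surj(3) row incl. EXOTIC.  CONDITIONAL on `hS24`; nothing booked.
[cite: Sakamoto2024, §2 (H.2) (p. 921), §4 and Thm. 4.4 (p. 926)] [cite: Rubin2011, Def. 1.9.6 and Def. 2.1.3 (pp. 14, 17)] -/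
theorem exists_kolyvaginDatum_kolyvaginSystems_freeRankOne_levelOne_of_surj
    (hS24 : Sakamoto2024.kolyvaginSystems_freeRankOne_zmod_three_pow)
    [Finite (geomTorsion W ((3 : ℕ) : ℤ))]
    (h3 : W.HasSurjectiveModNGaloisRep ((3 : ℕ) : ℤ))
    (inv : LocalInvariants ℚ 3) (hperf : inv.IsPerfect) (hsum : inv.SumLocalTermEqZero)
    (hcompl : inv.SelmerComplement)
    (S : Finset (Place ℚ)) (hS : ∀ w : InfinitePlace ℚ, (Sum.inl w : Place ℚ) ∈ S)
    (h3S : ∀ v : HeightOneSpectrum (𝓞 ℚ), ((3 : ℕ) : 𝓞 ℚ) ∈ v.asIdeal → (Sum.inr v : Place ℚ) ∈ S)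
    (hbadS : ∀ v : HeightOneSpectrum (𝓞 ℚ), ¬ W.HasGoodReductionAt v → (Sum.inr v : Place ℚ) ∈ S) :
    ∃ (τ : absoluteGaloisGroup ℚ) (η : (q : HeightOneSpectrum (𝓞 ℚ)) → (ZMod (Ideal.absNorm q.asIdeal))ˣ)
      (D : KolyvaginDatum (W.torsionGaloisModule (((3 : ℕ) : ℤ) ^ 0 * ((3 : ℕ) : ℤ)))),
      τ ∈ rootsOfUnityFixer ℚ (3 ^ (0 + 1)) ∧
      Nonempty (cokerSubOne (W.torsionGaloisModule (((3 : ℕ) : ℤ) ^ 0 * ((3 : ℕ) : ℤ))) τ ≃+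
        ZMod (3 ^ (0 + 1))) ∧
      D.primes = frobeniusClassPrimes (W.torsionGaloisModule (((3 : ℕ) : ℤ) ^ 0 * ((3 : ℕ) : ℤ)))
        {v | (Sum.inr v : Place ℚ) ∈ S} τ (3 ^ (0 + 1)) ∧
      D.transverse =
        cyclotomicTransverse (W.torsionGaloisModule (((3 : ℕ) : ℤ) ^ 0 * ((3 : ℕ) : ℤ))) ∧
      D.HasCanonicalComparison (3 ^ (0 + 1)) η ∧
      (KolyvaginSystem.IsFreeRankOneZMod (D.kolyvaginSystems (propagatedSelmerStructure W 3 0))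
          (3 ^ (0 + 1)) ∧
        ∀ (d : Finset (HeightOneSpectrum (𝓞 ℚ))) (hd : D.IsLevel d),
          LocalInvariants.lambdaStar inv ((D.atLevel (propagatedSelmerStructure W 3 0) d).induced
            (W.torsionMulBy (((3 : ℕ) : ℤ) ^ 0) ((3 : ℕ) : ℤ))) 3 = 0 →
          Function.Bijective fun κ : D.kolyvaginSystems (propagatedSelmerStructure W 3 0) =>
            (⟨κ.1 d, ((KolyvaginDatum.mem_kolyvaginSystems_iff D _ κ.1).mp κ.2).mem_selmerGroup
                d hd⟩ : (D.atLevel (propagatedSelmerStructure W 3 0) d).selmerGroup)) :=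
  GaloisImage.exists_kolyvaginDatum_kolyvaginSystems_freeRankOne_levelOne_of_surj_of_localEuler W hS24
    h3 inv hperf hsum
    (UnramifiedCup.unramifiedOrthogonal_of_isPerfect inv Nat.prime_three.isPrimePow hperf) hcompl
    (EP.forall_localEulerPoincareCharacteristic_adicCompletion ℚ) S hS h3S hbadS

end EP

end Summit.BirchSwinnertonDyer.Rank1Residual.GaloisImage

end
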